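import Summits.MatrixMultiplication.MatrixMultiplication.Theorems.OutsiderSandwichDegenerationWitnessRate
import Summits.MatrixMultiplication.MatrixMultiplication.Theses.OutsiderSandwich

/-!
# OutsiderSandwich — degeneration witnesses, PART 3 of 3 (route items 30534–30538 by name)

LANDING SPLIT (decomp-mm-lander-1 g1, 2026-08-30; mechanical, for the 400-line lint) of the lens-4 gen-7 landing form
`OutsiderSandwichDegenerationWitness.lean` (sha256 `b3aed0e0…4934`, 767 lines; critic-CLEARED decomp-mm STATUS l.342,
rc0 · 0 sorry · std axioms; REQUESTS #14).  This part = source sections «TOP is equivalent to its degeneration form», «BOTTOM, pointwise», «The minimal-counterexample germ», «The filed aside statements», «The route items by name» (source lines 431–765), copied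
byte-identically.  It imports PART 2 (`…DegenerationWitnessRate.lean`, hence PART 1) and `Theses.OutsiderSandwich`.  The original module docstring follows unchanged.
-/

/-!
# OutsiderSandwich — DEGENERATION witnesses are sound instruments for both pieces
(decomp-mm lens 4 «minimal-counterexample / extremal reduction», gen 7)

The route `OutsiderSandwich` cuts `ω(ℂ) = 2` into TOP = `CwTwoMMPerfect` (matrix products fill
the Kronecker powers of the little Coppersmith–Winograd tensor `cw₂` at the full flattening rate:
`⟨m,m,m⟩ ≤ cw₂^{⊠N}` with `m² ≥ 3^{(1-ε)N}` cofinally) and BOTTOM = `LaserMergeOptimal` (every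
`⟨m,m,m⟩ ≤ cw₂^{⊠N}` has `m² ≤ 2^{(ℓ(ω)+ε)N}` eventually).  Both pieces are stated with honest
RESTRICTIONS.  The census cell's new numerical objects (K5, 2026-08-30) are DEGENERATIONS:
`⟨3,3,3⟩ ⊴ cw₂^{⊠3}` of approximation order `1` (residual `3·10⁻¹⁵`), where the restriction
`⟨3,3,3⟩ ≤ cw₂^{⊠3}` shows only a border signature.  This file proves, ω-free and in kernel, that
degeneration witnesses are as good as restriction witnesses for everything the route measures:

* `restrictsTo_pad_of_isApproxRestriction` — **padding**: a degeneration of order `h`,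
  `⟨m,m,m⟩ ⊴_h cw₂^{⊠N}`, plus `L` fresh copies of `cw₂` with `2^L ≥ (h+1)²`, is an honest
  restriction `⟨m,m,m⟩ ≤ cw₂^{⊠(N+L)}` (BCS (15.26): `t ⊴_h s ⟹ t ≤ s ⊗ M_h`, `R(M_h) ≤ (h+1)²`,
  and `⟨2^L⟩ ≤ cw₂^{⊠L}` by zeroing);
* `restrictsTo_pow_pad_of_isApproxRestriction` — powers first, padding once:
  `⟨m^k,m^k,m^k⟩ ≤ cw₂^{⊠(kN+L)}` whenever `2^L ≥ (kh+1)²`, so the padding cost is `O(log k)`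
  copies and vanishes in the rate;
* `rate_of_algDegeneratesTo` — hence ONE degeneration witness `⟨m,m,m⟩ ⊴ cw₂^{⊠N}` (any `N`)
  gives the ω-free rate rung `CwTwoRate c` (cofinally many `⟨m',m',m'⟩ ≤ cw₂^{⊠N'}` with
  `c^{N'} ≤ m'²`) for EVERY `c` with `c^N < m²`;
* `cwTwoMMPerfectDeg_iff` — TOP is equivalent to its degeneration form (aside `CwTwoMMPerfectDegIff`);
* `laserMergeOptimal_iff_pointwise` — BOTTOM has an `ε`-free, `N₀`-free normal form: for every
  single level `N ≥ 1`, every `⟨m,m,m⟩ ≤ cw₂^{⊠N}` has `m² ≤ 2^{ℓ(ω)·N}` (aside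
  `LaserMergeOptimalPointwiseIff`), and then also every DEGENERATION `⟨m,m,m⟩ ⊴ cw₂^{⊠N}` does
  (`pointwise_deg_of_laserMergeOptimal`).  So a finite degeneration witness with `m^{2/N} > 2^{ℓ(ω̄)}
  = 2.7154` refutes BOTTOM at the record exponent exactly as a restriction witness would.

All statements are over the tree's `TensorRestrictsTo`, `IsApproxRestriction`, `AlgDegeneratesTo`,
`kroneckerPow`, `cwTensor`, `matMulTensor`, `coeffTensor`; no new definitions of Props.
-/

set_option linter.dupNamespace false

namespace Summit.MatrixMultiplication.MatrixMultiplication.Theorems.OutsiderSandwichDegenerationWitness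

open Polynomial
open Literature.Computability.AlgebraicComplexity

/-! ## TOP is equivalent to its degeneration form -/

section Top

/-- **TOP from degeneration witnesses**: if for every `ε > 0` cofinally many levels `N` carry a
DEGENERATION `⟨m,m,m⟩ ⊴ cw₂^{⊠N}` with `m² ≥ 3^{(1-ε)N}`, then `CwTwoMMPerfect` (honest restrictions)
holds. [cite: BurgisserClausenShokrollahi1997, (15.26)] -/
theorem cwTwoMMPerfect_of_deg
    (hT : ∀ ε : ℝ, 0 < ε → ∀ N₀ : ℕ, ∃ N : ℕ, N₀ ≤ N ∧ ∃ m : ℕ,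
      AlgDegeneratesTo (kroneckerPow (cwTensor ℂ 2) N) (matMulTensor ℂ m m m) ∧
        (3 : ℝ) ^ ((1 - ε) * N) ≤ (m : ℝ) ^ 2) :
    ∀ ε : ℝ, 0 < ε → ∀ N₀ : ℕ, ∃ N : ℕ, N₀ ≤ N ∧ ∃ m : ℕ,
      TensorRestrictsTo (kroneckerPow (cwTensor ℂ 2) N) (matMulTensor ℂ m m m) ∧
        (3 : ℝ) ^ ((1 - ε) * N) ≤ (m : ℝ) ^ 2 := by
  intro ε hε N₀
  obtain ⟨N, hN1, m, hd, hle⟩ := hT (ε / 2) (by positivity) 1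
  have hc0 : (0 : ℝ) ≤ (3 : ℝ) ^ (1 - ε) := (Real.rpow_pos_of_pos (by norm_num) _).le
  have hNpos : (0 : ℝ) < N := by exact_mod_cast hN1
  have hcN : ((3 : ℝ) ^ (1 - ε)) ^ N < (m : ℝ) ^ 2 := by
    refine lt_of_lt_of_le ?_ hle
    rw [← Real.rpow_natCast, ← Real.rpow_mul (by norm_num)]
    exact Real.rpow_lt_rpow_of_exponent_lt (by norm_num) (by nlinarith)
  obtain ⟨N', hN', m', hI, hrate⟩ := rate_of_algDegeneratesTo hd hc0 hcN N₀
  refine ⟨N', hN', m', hI, ?_⟩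
  calc (3 : ℝ) ^ ((1 - ε) * N') = ((3 : ℝ) ^ (1 - ε)) ^ N' := by
        rw [Real.rpow_mul (by norm_num), Real.rpow_natCast]
    _ ≤ (m' : ℝ) ^ 2 := hrate

/-- The trivial direction: restriction witnesses are degeneration witnesses. [cite: BurgisserClausenShokrollahi1997, (15.20)] -/
theorem deg_of_cwTwoMMPerfect
    (hT : Summit.MatrixMultiplication.MatrixMultiplication.Theses.OutsiderSandwich.CwTwoMMPerfect) :
    ∀ ε : ℝ, 0 < ε → ∀ N₀ : ℕ, ∃ N : ℕ, N₀ ≤ N ∧ ∃ m : ℕ,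
      AlgDegeneratesTo (kroneckerPow (cwTensor ℂ 2) N) (matMulTensor ℂ m m m) ∧
        (3 : ℝ) ^ ((1 - ε) * N) ≤ (m : ℝ) ^ 2 := by
  intro ε hε N₀
  obtain ⟨N, hN, m, hI, hle⟩ := hT ε hε N₀
  exact ⟨N, hN, m, hI.algDegeneratesTo, hle⟩

/-- **TOP ⟺ TOP by degenerations.** [cite: BurgisserClausenShokrollahi1997, (15.26)] -/
theorem cwTwoMMPerfect_iff_deg :
    Summit.MatrixMultiplication.MatrixMultiplication.Theses.OutsiderSandwich.CwTwoMMPerfect ↔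
    ∀ ε : ℝ, 0 < ε → ∀ N₀ : ℕ, ∃ N : ℕ, N₀ ≤ N ∧ ∃ m : ℕ,
      AlgDegeneratesTo (kroneckerPow (cwTensor ℂ 2) N) (matMulTensor ℂ m m m) ∧
        (3 : ℝ) ^ ((1 - ε) * N) ≤ (m : ℝ) ^ 2 :=
  ⟨deg_of_cwTwoMMPerfect, cwTwoMMPerfect_of_deg⟩

end Top

/-! ## BOTTOM, pointwise: every single level obeys the laser-merge rate, also for degenerations -/

section Bottom

/-- **BOTTOM ⟹ pointwise**: under `LaserMergeOptimal`, EVERY level `N ≥ 1` and every restriction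
`⟨m,m,m⟩ ≤ cw₂^{⊠N}` satisfy `m² ≤ 2^{ℓ(ω)·N}` exactly (no `ε`, no `N₀`): powers of the witness
live at levels `N(k+1) → ∞`, where BOTTOM bounds them by `2^{(ℓ+ε)N(k+1)}`; take `(k+1)`-th roots
and let `ε → 0`. [folklore] -/
theorem pointwise_of_laserMergeOptimal
    (hB : Summit.MatrixMultiplication.MatrixMultiplication.Theses.OutsiderSandwich.LaserMergeOptimal)
    {N m : ℕ} (hN : 1 ≤ N)
    (hI : TensorRestrictsTo (kroneckerPow (cwTensor ℂ 2) N) (matMulTensor ℂ m m m)) :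
    (m : ℝ) ^ 2 ≤ (2 : ℝ) ^ ((2 / 3 + 2 / omega ℂ * (Real.logb 2 3 - 2 / 3)) * N) := by
  set ℓ : ℝ := 2 / 3 + 2 / omega ℂ * (Real.logb 2 3 - 2 / 3) with hℓ
  rcases Nat.eq_zero_or_pos m with rfl | hm
  · simp only [Nat.cast_zero, ne_eq, OfNat.ofNat_ne_zero, not_false_eq_true, zero_pow]
    positivity
  have hNpos : (0 : ℝ) < N := by exact_mod_cast hN
  have hlog2 : 0 < Real.log 2 := Real.log_pos one_lt_two
  refine sq_le_two_rpow_of_log hm (le_of_forall_pos_le_add fun δ hδ => ?_)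
  have hε : 0 < δ / (N * Real.log 2) := by positivity
  obtain ⟨N₀, hN₀⟩ := hB _ hε
  have hle := hN₀ (N * (N₀ + 1)) (by nlinarith) (m ^ (N₀ + 1)) (mm_pow hI N₀)
  have hk : 1 ≤ m ^ (N₀ + 1) := Nat.one_le_pow _ _ hm
  have hlog := log_le_of_sq_le_two_rpow hk hle
  rw [Nat.cast_pow, Real.log_pow] at hlog
  push_cast at hlog
  have hk1 : (0 : ℝ) < (N₀ : ℝ) + 1 := by positivity
  have e : (ℓ + δ / (N * Real.log 2)) * (N * ((N₀ : ℝ) + 1)) * Real.log 2 =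
      ((N₀ : ℝ) + 1) * (ℓ * N * Real.log 2 + δ) := by
    field_simp
  rw [e] at hlog
  have h2 : ((N₀ : ℝ) + 1) * (2 * Real.log m) ≤ ((N₀ : ℝ) + 1) * (ℓ * N * Real.log 2 + δ) := by
    linarith
  exact le_of_mul_le_mul_left h2 hk1

/-- **pointwise ⟹ BOTTOM** (`N₀ = 1`, drop the `ε`). [folklore] -/
theorem laserMergeOptimal_of_pointwise
    (h : ∀ N m : ℕ, 1 ≤ N →
      TensorRestrictsTo (kroneckerPow (cwTensor ℂ 2) N) (matMulTensor ℂ m m m) →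
        (m : ℝ) ^ 2 ≤ (2 : ℝ) ^ ((2 / 3 + 2 / omega ℂ * (Real.logb 2 3 - 2 / 3)) * N)) :
    ∀ ε : ℝ, 0 < ε → ∃ N₀ : ℕ, ∀ N : ℕ, N₀ ≤ N → ∀ m : ℕ,
      TensorRestrictsTo (kroneckerPow (cwTensor ℂ 2) N) (matMulTensor ℂ m m m) →
        (m : ℝ) ^ 2 ≤ (2 : ℝ) ^ ((2 / 3 + 2 / omega ℂ * (Real.logb 2 3 - 2 / 3) + ε) * N) := by
  intro ε hε
  refine ⟨1, fun N hN m hI => (h N m hN hI).trans ?_⟩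
  refine Real.rpow_le_rpow_of_exponent_le (by norm_num) ?_
  have : (0 : ℝ) ≤ N := Nat.cast_nonneg N
  nlinarith

/-- **BOTTOM ⟺ its pointwise normal form.** [folklore] -/
theorem laserMergeOptimal_iff_pointwise :
    Summit.MatrixMultiplication.MatrixMultiplication.Theses.OutsiderSandwich.LaserMergeOptimal ↔
    ∀ N m : ℕ, 1 ≤ N →
      TensorRestrictsTo (kroneckerPow (cwTensor ℂ 2) N) (matMulTensor ℂ m m m) →
        (m : ℝ) ^ 2 ≤ (2 : ℝ) ^ ((2 / 3 + 2 / omega ℂ * (Real.logb 2 3 - 2 / 3)) * N) :=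
  ⟨fun hB _ _ hN hI => pointwise_of_laserMergeOptimal hB hN hI, laserMergeOptimal_of_pointwise⟩

/-- **BOTTOM bounds DEGENERATION witnesses too**: under `LaserMergeOptimal`, every degeneration
`⟨m,m,m⟩ ⊴ cw₂^{⊠N}` (`N ≥ 1`) has `m² ≤ 2^{ℓ(ω)·N}` — the padded powers sit at levels
`N·2^j + 2(j+h+1)` whose pointwise bounds, after `2^j`-th roots, tend to `2^{ℓ N}`.  Hence a finite
degeneration witness with `m^{2/N} > 2^{ℓ(ω')}` refutes `ω ≤ ω'`-worlds of BOTTOM exactly like a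
restriction witness (the census's kill test for BOTTOM accepts degenerations). [folklore] -/
theorem pointwise_deg_of_laserMergeOptimal
    (hB : Summit.MatrixMultiplication.MatrixMultiplication.Theses.OutsiderSandwich.LaserMergeOptimal)
    {N m : ℕ} (hN : 1 ≤ N)
    (hd : AlgDegeneratesTo (kroneckerPow (cwTensor ℂ 2) N) (matMulTensor ℂ m m m)) :
    (m : ℝ) ^ 2 ≤ (2 : ℝ) ^ ((2 / 3 + 2 / omega ℂ * (Real.logb 2 3 - 2 / 3)) * N) := by
  set ℓ : ℝ := 2 / 3 + 2 / omega ℂ * (Real.logb 2 3 - 2 / 3) with hℓ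
  rcases Nat.eq_zero_or_pos m with rfl | hm
  · simp only [Nat.cast_zero, ne_eq, OfNat.ofNat_ne_zero, not_false_eq_true, zero_pow]
    positivity
  obtain ⟨h, A, B, C, hd⟩ := hd
  have hlog2 : 0 < Real.log 2 := Real.log_pos one_lt_two
  have hω : 2 ≤ omega ℂ := omega_two_le ℂ
  have hℓ0 : 0 ≤ ℓ := by
    have h1 : 0 < Real.logb 2 3 - 2 / 3 := by
      have : 1 < Real.logb 2 3 := by
        rw [Real.lt_logb_iff_rpow_lt (by norm_num) (by norm_num), Real.rpow_one]; norm_num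
      linarith
    positivity
  -- every padded level: 2^j · 2 log m ≤ ℓ (N 2^j + 2(j+h+1)) log 2
  have hlev : ∀ j : ℕ, 2 * Real.log m ≤
      ℓ * N * Real.log 2 + ℓ * Real.log 2 * 2 * (((j : ℝ) + h + 1) / 2 ^ j) := by
    intro j
    have hNj : 1 ≤ N * 2 ^ j + 2 * (j + h + 1) := by omega
    have hle := pointwise_of_laserMergeOptimal hB hNj (restrictsTo_level hd j)
    have hk : 1 ≤ m ^ 2 ^ j := Nat.one_le_pow _ _ hm
    have hlog := log_le_of_sq_le_two_rpow hk hle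
    rw [Nat.cast_pow, Real.log_pow] at hlog
    push_cast at hlog
    have h2j : (0 : ℝ) < 2 ^ j := by positivity
    have e : ℓ * N * Real.log 2 + ℓ * Real.log 2 * 2 * (((j : ℝ) + h + 1) / 2 ^ j) =
        (ℓ * N * Real.log 2 * 2 ^ j + ℓ * Real.log 2 * 2 * ((j : ℝ) + h + 1)) / 2 ^ j := by
      field_simp
    rw [e, le_div_iff₀ h2j]
    rw [← hℓ] at hlog
    linarith [hlog]
  have ht : Filter.Tendsto
      (fun j : ℕ => ℓ * N * Real.log 2 + ℓ * Real.log 2 * 2 * (((j : ℝ) + h + 1) / 2 ^ j))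
      Filter.atTop (nhds (ℓ * N * Real.log 2 + ℓ * Real.log 2 * 2 * 0)) :=
    tendsto_const_nhds.add ((tendsto_pad_div h).const_mul _)
  rw [mul_zero, add_zero] at ht
  have key : 2 * Real.log m ≤ ℓ * N * Real.log 2 :=
    ge_of_tendsto ht (Filter.Eventually.of_forall hlev)
  exact sq_le_two_rpow_of_log hm key

end Bottom

/-! ## The minimal-counterexample germ: TOP ⟺ asymptotic healing of `¬ I(2,3)`

Flattening forbids the perfect finite format `⟨3,3,3⟩ ≤ cw₂^{⊠2}` (`9 > 2^2·…`; aside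
`MMThreeNotInCwTwoPowTwo`), and `(N,m) = (2,3)` is the MINIMAL format at which perfection `m² = 3^N`
is even arithmetically possible.  TOP says exactly that this one forbidden instance heals in the
limit along cubes `m = 3^k`: for every `δ > 0`, all large `k` admit `⟨3^k,3^k,3^k⟩ ≤ cw₂^{⊠N}` at
some level `N ≤ (2+δ)k` (necessarily `N ≥ 2k` by flattening). -/

section Germ

/-- **TOP ⟹ germ.**  One TOP witness `(N, m)` with `m² ≥ 3^{(1-ε)N}`, `ε = δ/(4+δ)`, powered up
`j = ⌊k·log 3/log m⌋ + 1` times and shrunk to the cube `3^k ≤ m^j`, sits at level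
`N·j ≤ (2+δ/2)k + N ≤ (2+δ)k` once `k ≥ 2N/δ`. [folklore] -/
theorem germ_of_cwTwoMMPerfect
    (hT : Summit.MatrixMultiplication.MatrixMultiplication.Theses.OutsiderSandwich.CwTwoMMPerfect) :
    ∀ δ : ℝ, 0 < δ → ∃ k₀ : ℕ, ∀ k : ℕ, k₀ ≤ k → ∃ N : ℕ, (N : ℝ) ≤ (2 + δ) * k ∧
      TensorRestrictsTo (kroneckerPow (cwTensor ℂ 2) N) (matMulTensor ℂ (3 ^ k) (3 ^ k) (3 ^ k)) := by
  intro δ hδ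
  have h4 : (0 : ℝ) < 4 + δ := by positivity
  have h1ε : 0 < 1 - δ / (4 + δ) := by
    rw [sub_pos, div_lt_one h4]
    linarith
  obtain ⟨N, hN1, m, hI, hle⟩ := hT (δ / (4 + δ)) (by positivity) 1
  have hNpos : (0 : ℝ) < N := by exact_mod_cast hN1
  have h3pow : (1 : ℝ) < (3 : ℝ) ^ ((1 - δ / (4 + δ)) * N) :=
    Real.one_lt_rpow (by norm_num) (by positivity)
  have hm1 : (1 : ℝ) < (m : ℝ) := by
    by_contra hcon
    have hcon := not_lt.mp hcon
    have hm0 : (0 : ℝ) ≤ m := Nat.cast_nonneg m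
    have : (m : ℝ) ^ 2 ≤ 1 := by nlinarith
    linarith
  have hlogm : 0 < Real.log m := Real.log_pos hm1
  have hlog3 : 0 < Real.log 3 := Real.log_pos (by norm_num)
  -- the exponent of the witness: `N·log 3 ≤ (2 + δ/2)·log m`
  have hratio : (N : ℝ) * Real.log 3 ≤ (2 + δ / 2) * Real.log m := by
    have hlog := Real.log_le_log (by positivity) hle
    rw [Real.log_rpow (by norm_num), Real.log_pow] at hlog
    push_cast at hlog
    have e1 : (1 - δ / (4 + δ)) * (4 + δ) = 4 := by
      field_simp
      ring
    calc (N : ℝ) * Real.log 3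
        = (4 + δ) / 4 * ((1 - δ / (4 + δ)) * N * Real.log 3) := by
          have e2 : (N : ℝ) * Real.log 3 = (1 - δ / (4 + δ)) * (4 + δ) / 4 * (N * Real.log 3) := by
            rw [e1]; ring
          rw [e2]; ring
      _ ≤ (4 + δ) / 4 * (2 * Real.log m) := mul_le_mul_of_nonneg_left hlog (by positivity)
      _ = (2 + δ / 2) * Real.log m := by ring
  refine ⟨⌈2 * N / δ⌉₊, fun k hk => ?_⟩
  have hkr : (0 : ℝ) ≤ k := Nat.cast_nonneg k
  have hk' : 2 * (N : ℝ) / δ ≤ k := (Nat.le_ceil _).trans (by exact_mod_cast hk)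
  have hNk : (N : ℝ) ≤ δ / 2 * k := by
    rw [div_le_iff₀ hδ] at hk'
    linarith
  obtain ⟨j, hj1, hj2⟩ : ∃ j : ℕ, (k : ℝ) * Real.log 3 / Real.log m < (j : ℝ) + 1 ∧
      (j : ℝ) ≤ (k : ℝ) * Real.log 3 / Real.log m :=
    ⟨⌊(k : ℝ) * Real.log 3 / Real.log m⌋₊, Nat.lt_floor_add_one _, Nat.floor_le (by positivity)⟩
  -- `3^k ≤ m^{j+1}`
  have hpow : 3 ^ k ≤ m ^ (j + 1) := by
    have e1 : (k : ℝ) * Real.log 3 ≤ ((j : ℝ) + 1) * Real.log m := by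
      rw [div_lt_iff₀ hlogm] at hj1
      exact hj1.le
    have e2 : Real.log ((3 : ℝ) ^ k) ≤ Real.log ((m : ℝ) ^ (j + 1)) := by
      rw [Real.log_pow, Real.log_pow]; push_cast; exact e1
    have e3 : ((3 ^ k : ℕ) : ℝ) ≤ ((m ^ (j + 1) : ℕ) : ℝ) := by
      push_cast
      exact (Real.log_le_log_iff (by positivity) (by positivity)).mp e2
    exact_mod_cast e3
  refine ⟨N * (j + 1), ?_, (mm_pow hI j).trans
    (Literature.Barriers.MatrixMultiplication.tensorRestrictsTo_matMulTensor_of_le ℂ hpow hpow hpow)⟩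
  push_cast
  have hq : (N : ℝ) * Real.log 3 / Real.log m ≤ 2 + δ / 2 := by
    rw [div_le_iff₀ hlogm]
    exact hratio
  calc (N : ℝ) * (j + 1) ≤ N * ((k : ℝ) * Real.log 3 / Real.log m + 1) :=
        mul_le_mul_of_nonneg_left (by linarith) hNpos.le
    _ = k * ((N : ℝ) * Real.log 3 / Real.log m) + N := by ring
    _ ≤ k * (2 + δ / 2) + δ / 2 * k := by nlinarith [mul_le_mul_of_nonneg_left hq hkr]
    _ = (2 + δ) * k := by ring

/-- **germ ⟹ TOP.**  Flattening gives `N ≥ 2k → ∞` along the germ, and `N ≤ (2+ε)k` gives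
`m² = 9^k ≥ 3^{(1-ε)N}` since `(1-ε)(2+ε) ≤ 2`. [folklore] -/
theorem cwTwoMMPerfect_of_germ
    (hG : ∀ δ : ℝ, 0 < δ → ∃ k₀ : ℕ, ∀ k : ℕ, k₀ ≤ k → ∃ N : ℕ, (N : ℝ) ≤ (2 + δ) * k ∧
      TensorRestrictsTo (kroneckerPow (cwTensor ℂ 2) N) (matMulTensor ℂ (3 ^ k) (3 ^ k) (3 ^ k))) :
    ∀ ε : ℝ, 0 < ε → ∀ N₀ : ℕ, ∃ N : ℕ, N₀ ≤ N ∧ ∃ m : ℕ,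
      TensorRestrictsTo (kroneckerPow (cwTensor ℂ 2) N) (matMulTensor ℂ m m m) ∧
        (3 : ℝ) ^ ((1 - ε) * N) ≤ (m : ℝ) ^ 2 := by
  intro ε hε N₀
  obtain ⟨k₀, hk₀⟩ := hG ε hε
  obtain ⟨N, hNle, hI⟩ := hk₀ (max k₀ N₀) (le_max_left _ _)
  set k := max k₀ N₀ with hk
  have hkN₀ : N₀ ≤ k := le_max_right _ _
  -- flattening: `9^k ≤ 3^N`, so `2k ≤ N`
  have hflat := sq_le_three_pow_of_mm hI
  rw [← pow_mul, show (3 : ℕ) ^ (k * 2) = 3 ^ (2 * k) by rw [mul_comm]] at hflat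
  have h2k : 2 * k ≤ N := (Nat.pow_le_pow_iff_right (by norm_num)).mp hflat
  refine ⟨N, hkN₀.trans ((Nat.le_mul_of_pos_left k two_pos).trans h2k), 3 ^ k, hI, ?_⟩
  -- `3^{(1-ε)N} ≤ (3^k)² = 3^{2k}`
  rw [Nat.cast_pow, Nat.cast_ofNat, ← pow_mul, ← Real.rpow_natCast]
  refine Real.rpow_le_rpow_of_exponent_le (by norm_num) ?_
  push_cast
  have hkr : (0 : ℝ) ≤ k := Nat.cast_nonneg k
  have hNr : (0 : ℝ) ≤ N := Nat.cast_nonneg N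
  rcases le_or_gt ε 1 with hε1 | hε1
  · -- (1-ε) N ≤ (1-ε)(2+ε) k = 2k - εk - ε²k ≤ 2k
    nlinarith [mul_le_mul_of_nonneg_left hNle (by linarith : (0 : ℝ) ≤ 1 - ε),
      mul_nonneg hε.le hkr, mul_nonneg (mul_nonneg hε.le hε.le) hkr]
  · nlinarith

/-- **TOP ⟺ the `(2,3)`-germ.** [folklore] -/
theorem cwTwoMMPerfect_iff_germ :
    Summit.MatrixMultiplication.MatrixMultiplication.Theses.OutsiderSandwich.CwTwoMMPerfect ↔
    ∀ δ : ℝ, 0 < δ → ∃ k₀ : ℕ, ∀ k : ℕ, k₀ ≤ k → ∃ N : ℕ, (N : ℝ) ≤ (2 + δ) * k ∧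
      TensorRestrictsTo (kroneckerPow (cwTensor ℂ 2) N) (matMulTensor ℂ (3 ^ k) (3 ^ k) (3 ^ k)) :=
  ⟨germ_of_cwTwoMMPerfect, cwTwoMMPerfect_of_germ⟩

end Germ



/-! ## The filed aside statements, verbatim (route edit g7), with their proofs -/

section Filed

/-- the aside `CwTwoRateOfDegeneration` as filed on the route (g7), proved. [folklore] -/
theorem cwTwoRateOfDegeneration_filed :
    ∀ N m : ℕ, Literature.Computability.AlgebraicComplexity.AlgDegeneratesTo (Literature.Computability.AlgebraicComplexity.kroneckerPow (Literature.Computability.AlgebraicComplexity.cwTensor ℂ 2) N) (Literature.Computability.AlgebraicComplexity.matMulTensor ℂ m m m) → ∀ c : ℝ, 0 ≤ c → c ^ N < (m : ℝ) ^ 2 → ∀ N₀ : ℕ, ∃ N' : ℕ, N₀ ≤ N' ∧ ∃ m' : ℕ, Literature.Computability.AlgebraicComplexity.TensorRestrictsTo (Literature.Computability.AlgebraicComplexity.kroneckerPow (Literature.Computability.AlgebraicComplexity.cwTensor ℂ 2) N') (Literature.Computability.AlgebraicComplexity.matMulTensor ℂ m' m' m') ∧ c ^ N' ≤ (m' : ℝ)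 ^ 2 :=
  fun _ _ hd _ hc0 hc => rate_of_algDegeneratesTo hd hc0 hc

/-- the aside `CwTwoMMPerfectDegIff` as filed on the route (g7), proved. [folklore] -/
theorem cwTwoMMPerfectDegIff_filed :
    Summit.MatrixMultiplication.MatrixMultiplication.Theses.OutsiderSandwich.CwTwoMMPerfect ↔ ∀ ε : ℝ, 0 < ε → ∀ N₀ : ℕ, ∃ N : ℕ, N₀ ≤ N ∧ ∃ m : ℕ, Literature.Computability.AlgebraicComplexity.AlgDegeneratesTo (Literature.Computability.AlgebraicComplexity.kroneckerPow (Literature.Computability.AlgebraicComplexity.cwTensor ℂ 2) N) (Literature.Computability.AlgebraicComplexity.matMulTensor ℂ m m m) ∧ (3 : ℝ) ^ ((1 - ε) * N) ≤ (m : ℝ) ^ 2 :=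
  cwTwoMMPerfect_iff_deg

/-- the aside `LaserMergeOptimalPointwiseIff` as filed on the route (g7), proved. [folklore] -/
theorem laserMergeOptimalPointwiseIff_filed :
    Summit.MatrixMultiplication.MatrixMultiplication.Theses.OutsiderSandwich.LaserMergeOptimal ↔ ∀ N m : ℕ, 1 ≤ N → Literature.Computability.AlgebraicComplexity.TensorRestrictsTo (Literature.Computability.AlgebraicComplexity.kroneckerPow (Literature.Computability.AlgebraicComplexity.cwTensor ℂ 2) N) (Literature.Computability.AlgebraicComplexity.matMulTensor ℂ m m m) → (m : ℝ) ^ 2 ≤ (2 : ℝ) ^ ((2 / 3 + 2 / Literature.Computability.AlgebraicComplexity.omega ℂ * (Real.logb 2 3 - 2 / 3)) * N) :=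
  laserMergeOptimal_iff_pointwise

/-- the aside `LaserMergeBoundsDegenerations` as filed on the route (g7), proved. [folklore] -/
theorem laserMergeBoundsDegenerations_filed :
    Summit.MatrixMultiplication.MatrixMultiplication.Theses.OutsiderSandwich.LaserMergeOptimal → ∀ N m : ℕ, 1 ≤ N → Literature.Computability.AlgebraicComplexity.AlgDegeneratesTo (Literature.Computability.AlgebraicComplexity.kroneckerPow (Literature.Computability.AlgebraicComplexity.cwTensor ℂ 2) N) (Literature.Computability.AlgebraicComplexity.matMulTensor ℂ m m m) → (m : ℝ) ^ 2 ≤ (2 : ℝ) ^ ((2 / 3 + 2 / Literature.Computability.AlgebraicComplexity.omega ℂ * (Real.logb 2 3 - 2 / 3)) * N) :=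
  fun hB _ _ hN hd => pointwise_deg_of_laserMergeOptimal hB hN hd

/-- the aside `CwTwoMMPerfectGermIff` as filed on the route (g7), proved. [folklore] -/
theorem cwTwoMMPerfectGermIff_filed :
    Summit.MatrixMultiplication.MatrixMultiplication.Theses.OutsiderSandwich.CwTwoMMPerfect ↔ ∀ δ : ℝ, 0 < δ → ∃ k₀ : ℕ, ∀ k : ℕ, k₀ ≤ k → ∃ N : ℕ, (N : ℝ) ≤ (2 + δ) * k ∧ Literature.Computability.AlgebraicComplexity.TensorRestrictsTo (Literature.Computability.AlgebraicComplexity.kroneckerPow (Literature.Computability.AlgebraicComplexity.cwTensor ℂ 2) N) (Literature.Computability.AlgebraicComplexity.matMulTensor ℂ (3 ^ k) (3 ^ k) (3 ^ k)) :=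
  cwTwoMMPerfect_iff_germ

end Filed

/-! ## The route items by name (rev 5, commit dd2ec603d463): asides 30534–30538 -/

section Holds

/-- item stmt-MatrixMultiplication-30534 · aside `CwTwoRateOfDegeneration` holds. [folklore] -/
theorem cwTwoRateOfDegeneration_holds : Summit.MatrixMultiplication.MatrixMultiplication.Theses.OutsiderSandwich.CwTwoRateOfDegeneration :=
  cwTwoRateOfDegeneration_filed

/-- item stmt-MatrixMultiplication-30535 · aside `CwTwoMMPerfectDegIff` holds. [folklore] -/
theorem cwTwoMMPerfectDegIff_holds : Summit.MatrixMultiplication.MatrixMultiplication.Theses.OutsiderSandwich.CwTwoMMPerfectDegIff :=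
  cwTwoMMPerfectDegIff_filed

/-- item stmt-MatrixMultiplication-30536 · aside `LaserMergeOptimalPointwiseIff` holds. [folklore] -/
theorem laserMergeOptimalPointwiseIff_holds : Summit.MatrixMultiplication.MatrixMultiplication.Theses.OutsiderSandwich.LaserMergeOptimalPointwiseIff :=
  laserMergeOptimalPointwiseIff_filed

/-- item stmt-MatrixMultiplication-30537 · aside `LaserMergeBoundsDegenerations` holds. [folklore] -/
theorem laserMergeBoundsDegenerations_holds : Summit.MatrixMultiplication.MatrixMultiplication.Theses.OutsiderSandwich.LaserMergeBoundsDegenerations :=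
  laserMergeBoundsDegenerations_filed

/-- item stmt-MatrixMultiplication-30538 · aside `CwTwoMMPerfectGermIff` holds. [folklore] -/
theorem cwTwoMMPerfectGermIff_holds : Summit.MatrixMultiplication.MatrixMultiplication.Theses.OutsiderSandwich.CwTwoMMPerfectGermIff :=
  cwTwoMMPerfectGermIff_filed

end Holds

end Summit.MatrixMultiplication.MatrixMultiplication.Theorems.OutsiderSandwichDegenerationWitness
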